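import Literature.MathematicalPhysics.QuantumLattice.SectorisedEffectiveActionBoundDBPlateau
import Literature.MathematicalPhysics.QuantumLattice.GrassmannGaussConvBinomialGram
import Literature.MathematicalPhysics.QuantumLattice.GrassmannChargeScaling
import HarnessLib

/-!
# The sectorised single-scale INCREMENT `effAction C G - G` in determinant-bound currency, plateau form:
# first order in BINOMIAL–GRAM form (Wick self-contractions of the higher kernels only) + the orders `≥ 2`

Topic `MathematicalPhysics/QuantumLattice`; sequel of `SectorisedEffectiveActionBoundDBPlateau` (the whole step
`‖map E(F′) (effAction C G)‖ ≤ cr cc^m ε^m ρ^{-(m+1)} e‖Ṽ‖_h/(1-θ)`, first order INCLUDED — hence a factor `≥ e·((κ+ρ)/ρ)^m` on the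
part of `G` that merely passes through the step) and of `GrassmannGaussConvBinomialGram` (the first-order part kernel by kernel in
binomial–Gram form).  Here the two halves of the INCREMENT of one single-scale integration (Benfatto–Giuliani–Mastropietro 2006,
(2.61)–(2.63), (2.66): `𝒱^{(h-1)} - 𝒱^{(h)} = (self-contractions) + Σ_{n ≥ 2} 𝓔ᵀ/n!`) are read through a substitution `f` (sector fields `Ṽ ↦ V = map f Ṽ`,
pulled-back covariance `C′ = fᵀ C f`) and an analysis map `g` (the sector decomposition of the output, Young costs `cr·cc^m`):

* §1 (generic label sets) `kernelNorm_kernel_map_gaussConv_sub_le_binomial_of_gramBounded` —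
  `‖kernel_{2p} (map g (e^{Δ_C}V - V))‖_ε ≤ cr·cc^{2p-1}·ε^{2p-1}·Σ_{m' > p} C(2m', 2p) κ^{2m'-2p} ‖kernel_{2m'} Ṽ‖_1` (FIRST ORDER: identity part
  absent, no pairing factorial, no row/column sums), and `kernelNorm_kernel_map_effAction_sub_gaussConv_le_of_gramBounded` —
  `‖kernel_{m+1} (map g (effAction C V - e^{Δ_C}V))‖_ε ≤ cr·cc^m·ε^m·ρ^{-(m+1)}·e‖Ṽ‖_h·θ/(1-θ)` (ORDERS `≥ 2`);
* §2 (Hubbard torus, plateau transfer) `map_sectorAnalysis_map_sectorPreimage_of_plateau`, `map_sectorAnalysis_gaussConv_map_sectorPreimage_of_plateau`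
  — inside any `F′`-measurement the input `G` may be replaced by the push-forward of its sector preimage also for the identity and for the
  Gaussian convolution (twins of `map_sectorAnalysis_effAction_map_sectorPreimage_of_plateau`); hence
  **`hubbardSectorKernelNorm_gaussConv_sub_le_binomial_of_gramBounded_of_plateau`** (the first-order increment of the sectorised
  kernels of `G` across one slice, in every even degree `2p ≥ 2` and every constraint set: `≤ cr cc^{2p-1} ε_x^{2p-1} Σ_{m'>p} C(2m',2p) κ^{2m'-2p} N̄(m')`,
  `N̄(m') = ε_x‖G‖_{F,univ,2m'}`) and **`hubbardSectorKernelNorm_effAction_sub_gaussConv_le_of_gramBounded_of_plateau`** (the orders `≥ 2`: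
  `≤ cr cc^m ε_x^m ρ^{-(m+1)} e‖G‖_h θ̄/(1-θ̄)`).

This is the one-level bound a multi-level (birth-level) iteration of single-scale steps consumes: the kernels of `𝒱_{j+1} - 𝒱_j` born
at level `j+1`, with no constant charged on the kernels of `𝒱_j` that pass through (cell gate-hubbard-kl, K3 engine child, clause (E1):
E1-TOWER-AUDIT / E1-CORE-TARGET CT-3).  Everything is proved; no definition, no named fact.

## Sources

G. Benfatto, A. Giuliani, V. Mastropietro, Ann. Henri Poincaré 7 (2006) 809–898, (2.70)–(2.71a), (2.76)–(2.83), (2.61)–(2.63), (2.66)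
[`BenfattoGiulianiMastropietro2006`]; W. de Siqueira Pedra, M. Salmhofer, Comm. Math. Phys. 282 (2008) 797–818, Thm 1.3 [`PedraSalmhofer2008`];
K. Gawȩdzki, A. Kupiainen, Comm. Math. Phys. 102 (1985) 1–30, §3 [`GawedzkiKupiainen1985GrossNeveu`].
-/

noncomputable section

namespace Literature.MathematicalPhysics.QuantumLattice

open GrassmannAlgebra Finset Literature.Probability.LatticeModels
open scoped Nat

universe u

/-! ### §1 Generic label sets: the two halves of the increment read through `(f, g)` -/

section Generic

variable {𝕜 : Type*} [RCLike 𝕜] {Γ Γ' Γ'' : Type u} [Fintype Γ] [DecidableEq Γ] [Fintype Γ'] [DecidableEq Γ']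
  [Fintype Γ''] [DecidableEq Γ'']

/-- **First order of the increment, read through `(f, g)`, binomial–Gram form** (BGM 2006 (2.61)–(2.63), (2.66) at first order, with
(2.70)–(2.71a)): `Ṽ` even with pinned kernel norms `‖kernel_{2m'} Ṽ‖_1 ≤ N(m')`, `C′ = fᵀ C f` replica-Gram-bounded with constant `κ ≥ 0`,
analysis costs `(cr, cc)` of `g ∘ f`; then for every `p ≥ 1`,
`‖kernel_{2p} (map g (e^{Δ_C}(map f Ṽ) - map f Ṽ))‖_ε ≤ cr·cc^{2p-1}·ε^{2p-1}·Σ_{m' ≤ |Γ′|/2, p < m'} C(2m',2p) κ^{2m'-2p} N(m')`.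
[cite: BenfattoGiulianiMastropietro2006, (2.61)-(2.63), (2.66)] -/
theorem kernelNorm_kernel_map_gaussConv_sub_le_binomial_of_gramBounded
    (C : Matrix Γ Γ 𝕜) (f : (Γ' → 𝕜) →ₗ[𝕜] (Γ → 𝕜)) (g : (Γ → 𝕜) →ₗ[𝕜] (Γ'' → 𝕜))
    (Vt : GrassmannAlgebra 𝕜 Γ') (hVt : Vt ∈ evenPart 𝕜 Γ')
    {κ : ℝ} (hκ : 0 ≤ κ) (hGB : IsGramBoundedR ((LinearMap.toMatrix' f).transpose * C * LinearMap.toMatrix' f) κ)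
    (N : ℕ → ℝ) (hN0 : ∀ m', 0 ≤ N m') (hN : ∀ m', kernelNorm 1 (2 * m') (kernel 𝕜 Vt (2 * m')) ≤ N m')
    {cr cc : ℝ} (hcr0 : 0 ≤ cr) (hcc0 : 0 ≤ cc)
    (hrow' : ∀ X'', ∑ X', ‖(LinearMap.toMatrix' g * LinearMap.toMatrix' f) X'' X'‖ ≤ cr)
    (hcol' : ∀ X', ∑ X'', ‖(LinearMap.toMatrix' g * LinearMap.toMatrix' f) X'' X'‖ ≤ cc)
    {ε : ℝ} (hε : 0 ≤ ε) (p : ℕ) :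
    kernelNorm ε (2 * (p + 1)) (kernel 𝕜 (ExteriorAlgebra.map g
        (gaussConv 𝕜 C (ExteriorAlgebra.map f Vt) - ExteriorAlgebra.map f Vt)) (2 * (p + 1))) ≤
      cr * cc ^ (2 * p + 1) * ε ^ (2 * p + 1) *
        ∑ m' ∈ range (Fintype.card Γ' / 2 + 1),
          (if p + 1 < m' then ((2 * m').choose (2 * (p + 1)) : ℝ) * κ ^ (2 * m' - 2 * (p + 1)) * N m' else 0) := by
  set C' : Matrix Γ' Γ' 𝕜 := (LinearMap.toMatrix' f).transpose * C * LinearMap.toMatrix' f with hC'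
  set B : ℝ := ∑ m' ∈ range (Fintype.card Γ' / 2 + 1),
    (if p + 1 < m' then ((2 * m').choose (2 * (p + 1)) : ℝ) * κ ^ (2 * m' - 2 * (p + 1)) * N m' else 0) with hB
  have hB0 : 0 ≤ B := sum_nonneg fun m' _ => by
    split_ifs
    · exact mul_nonneg (mul_nonneg (Nat.cast_nonneg _) (pow_nonneg hκ _)) (hN0 m')
    · exact le_rfl
  -- the first-order increment in the auxiliary representation, degree `2(p+1) = (2p+1)+1`
  have haux : kernelNorm 1 (2 * p + 1 + 1) (kernel 𝕜 (gaussConv 𝕜 C' Vt - Vt) (2 * p + 1 + 1)) ≤ B :=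
    kernelNorm_succ_le_of_forall 1 (2 * p + 1) _ hB0 fun i w => by
      rw [one_pow, one_mul]
      exact sum_norm_kernel_gaussConv_sub_le_binomial_of_gramBounded C' hκ hGB Vt hVt N hN0
        (fun m' j w' => (pinnedSum_le_kernelNorm_one _ j w').trans (hN m')) (p := p + 1) i w
  -- read through `g ∘ f`
  have hsub : gaussConv 𝕜 C (ExteriorAlgebra.map f Vt) - ExteriorAlgebra.map f Vt = ExteriorAlgebra.map f (gaussConv 𝕜 C' Vt - Vt) := by
    rw [gaussConv_map, map_sub]
  show kernelNorm ε (2 * p + 1 + 1) (kernel 𝕜 (ExteriorAlgebra.map g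
      (gaussConv 𝕜 C (ExteriorAlgebra.map f Vt) - ExteriorAlgebra.map f Vt)) (2 * p + 1 + 1)) ≤ cr * cc ^ (2 * p + 1) * ε ^ (2 * p + 1) * B
  rw [hsub, map_map_eq_map_comp, kernelNorm_eq_pow_mul_kernelNorm_one hε]
  have hY := kernelNorm_kernel_map_le (g ∘ₗ f) hcr0 hcc0 (ε := 1)
    (by intro X''; rw [LinearMap.toMatrix'_comp]; exact hrow' X'')
    (by intro X'; simp only [LinearMap.toMatrix'_comp]; exact hcol' X') zero_le_one (gaussConv 𝕜 C' Vt - Vt) (2 * p + 1)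
  calc ε ^ (2 * p + 1) * kernelNorm 1 (2 * p + 1 + 1)
        (kernel 𝕜 (ExteriorAlgebra.map (g ∘ₗ f) (gaussConv 𝕜 C' Vt - Vt)) (2 * p + 1 + 1))
      ≤ ε ^ (2 * p + 1) * (cr * cc ^ (2 * p + 1) *
          kernelNorm 1 (2 * p + 1 + 1) (kernel 𝕜 (gaussConv 𝕜 C' Vt - Vt) (2 * p + 1 + 1))) :=
        mul_le_mul_of_nonneg_left hY (pow_nonneg hε _)
    _ ≤ ε ^ (2 * p + 1) * (cr * cc ^ (2 * p + 1) * B) :=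
        mul_le_mul_of_nonneg_left (mul_le_mul_of_nonneg_left haux (by positivity)) (pow_nonneg hε _)
    _ = cr * cc ^ (2 * p + 1) * ε ^ (2 * p + 1) * B := by ring

/-- **Orders `≥ 2` of the increment, read through `(f, g)`** (BGM 2006 (2.61)–(2.63), (2.66); Gawȩdzki–Kupiainen 1985, §3): `Ṽ` even without
constant part, `C′ = fᵀ C f` replica-Gram-bounded (`κ > 0`) with row/column sums `≤ α`, `θ = eα‖Ṽ‖_h/κ² < 1`, analysis costs `(cr, cc)`;
then in every degree `m + 1`,
`‖kernel_{m+1} (map g (effAction C (map f Ṽ) - e^{Δ_C}(map f Ṽ)))‖_ε ≤ cr·cc^m·ε^m·ρ^{-(m+1)}·e‖Ṽ‖_h·θ/(1-θ)`.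
[cite: BenfattoGiulianiMastropietro2006, (2.61)-(2.63), (2.66)] -/
theorem kernelNorm_kernel_map_effAction_sub_gaussConv_le_of_gramBounded
    (C : Matrix Γ Γ 𝕜) (f : (Γ' → 𝕜) →ₗ[𝕜] (Γ → 𝕜)) (g : (Γ → 𝕜) →ₗ[𝕜] (Γ'' → 𝕜))
    (Vt : GrassmannAlgebra 𝕜 Γ') (hVt : Vt ∈ evenPart 𝕜 Γ') (hVt0 : constPart 𝕜 Vt = 0)
    {κ : ℝ} (hκ : 0 < κ) (hGB : IsGramBoundedR ((LinearMap.toMatrix' f).transpose * C * LinearMap.toMatrix' f) κ)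
    {α : ℝ} (hα : 0 < α)
    (hrow : ∀ X, ∑ Y, ‖((LinearMap.toMatrix' f).transpose * C * LinearMap.toMatrix' f) X Y‖ ≤ α)
    (hcol : ∀ Y, ∑ X, ‖((LinearMap.toMatrix' f).transpose * C * LinearMap.toMatrix' f) X Y‖ ≤ α)
    {ρ : ℝ} (hρ : 0 < ρ)
    (hθ : Real.exp 1 * α * normV Γ' κ ρ (fun m' => kernelNorm 1 (2 * m') (kernel 𝕜 Vt (2 * m'))) / κ ^ 2 < 1)
    {cr cc : ℝ} (hcr0 : 0 ≤ cr) (hcc0 : 0 ≤ cc)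
    (hrow' : ∀ X'', ∑ X', ‖(LinearMap.toMatrix' g * LinearMap.toMatrix' f) X'' X'‖ ≤ cr)
    (hcol' : ∀ X', ∑ X'', ‖(LinearMap.toMatrix' g * LinearMap.toMatrix' f) X'' X'‖ ≤ cc)
    {ε : ℝ} (hε : 0 ≤ ε) (m : ℕ) :
    kernelNorm ε (m + 1) (kernel 𝕜 (ExteriorAlgebra.map g
        (effAction 𝕜 C (ExteriorAlgebra.map f Vt) - gaussConv 𝕜 C (ExteriorAlgebra.map f Vt))) (m + 1)) ≤
      cr * cc ^ m * ε ^ m * (ρ⁻¹ ^ (m + 1) *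
        (Real.exp 1 * normV Γ' κ ρ (fun m' => kernelNorm 1 (2 * m') (kernel 𝕜 Vt (2 * m')))) *
          (Real.exp 1 * α * normV Γ' κ ρ (fun m' => kernelNorm 1 (2 * m') (kernel 𝕜 Vt (2 * m'))) / κ ^ 2) /
          (1 - Real.exp 1 * α * normV Γ' κ ρ (fun m' => kernelNorm 1 (2 * m') (kernel 𝕜 Vt (2 * m'))) / κ ^ 2)) := by
  set C' : Matrix Γ' Γ' 𝕜 := (LinearMap.toMatrix' f).transpose * C * LinearMap.toMatrix' f with hC'
  set nV : ℝ := normV Γ' κ ρ (fun m' => kernelNorm 1 (2 * m') (kernel 𝕜 Vt (2 * m'))) with hnV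
  -- the tail in the auxiliary representation
  have hN0 : ∀ m', 0 ≤ kernelNorm 1 (2 * m') (kernel 𝕜 Vt (2 * m')) := fun m' => kernelNorm_nonneg zero_le_one _ _
  obtain ⟨-, htail⟩ := sum_norm_kernel_effAction_sub_gaussConv_le_of_gramBounded C' hκ hGB Vt hVt hVt0
    (fun m' => kernelNorm 1 (2 * m') (kernel 𝕜 Vt (2 * m'))) hN0 (fun m' j w => pinnedSum_le_kernelNorm_one _ j w) hα hrow hcol hρ hθ
  have hnV0 : 0 ≤ nV := normV_nonneg hκ.le hρ.le hN0
  have hθ0 : 0 ≤ Real.exp 1 * α * nV / κ ^ 2 := by positivity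
  have hT0 : 0 ≤ ρ⁻¹ ^ (m + 1) * (Real.exp 1 * nV) * (Real.exp 1 * α * nV / κ ^ 2) / (1 - Real.exp 1 * α * nV / κ ^ 2) :=
    div_nonneg (by positivity) (by linarith)
  have haux : kernelNorm 1 (m + 1) (kernel 𝕜 (effAction 𝕜 C' Vt - gaussConv 𝕜 C' Vt) (m + 1)) ≤
      ρ⁻¹ ^ (m + 1) * (Real.exp 1 * nV) * (Real.exp 1 * α * nV / κ ^ 2) / (1 - Real.exp 1 * α * nV / κ ^ 2) :=
    kernelNorm_succ_le_of_forall 1 m _ hT0 fun i w => by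
      rw [one_pow, one_mul]
      exact htail (Nat.succ_pos m) i w
  -- read through `g ∘ f`
  have hsub : effAction 𝕜 C (ExteriorAlgebra.map f Vt) - gaussConv 𝕜 C (ExteriorAlgebra.map f Vt) =
      ExteriorAlgebra.map f (effAction 𝕜 C' Vt - gaussConv 𝕜 C' Vt) := by
    rw [effAction_map, gaussConv_map, map_sub]
  rw [hsub, map_map_eq_map_comp, kernelNorm_eq_pow_mul_kernelNorm_one hε]
  have hY := kernelNorm_kernel_map_le (g ∘ₗ f) hcr0 hcc0 (ε := 1)
    (by intro X''; rw [LinearMap.toMatrix'_comp]; exact hrow' X'')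
    (by intro X'; simp only [LinearMap.toMatrix'_comp]; exact hcol' X') zero_le_one (effAction 𝕜 C' Vt - gaussConv 𝕜 C' Vt) m
  calc ε ^ m * kernelNorm 1 (m + 1) (kernel 𝕜 (ExteriorAlgebra.map (g ∘ₗ f) (effAction 𝕜 C' Vt - gaussConv 𝕜 C' Vt)) (m + 1))
      ≤ ε ^ m * (cr * cc ^ m * kernelNorm 1 (m + 1) (kernel 𝕜 (effAction 𝕜 C' Vt - gaussConv 𝕜 C' Vt) (m + 1))) :=
        mul_le_mul_of_nonneg_left hY (pow_nonneg hε _)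
    _ ≤ ε ^ m * (cr * cc ^ m * (ρ⁻¹ ^ (m + 1) * (Real.exp 1 * nV) * (Real.exp 1 * α * nV / κ ^ 2) /
          (1 - Real.exp 1 * α * nV / κ ^ 2))) :=
        mul_le_mul_of_nonneg_left (mul_le_mul_of_nonneg_left haux (by positivity)) (pow_nonneg hε _)
    _ = _ := by ring

end Generic

/-! ### §2 The Hubbard torus: plateau transfer for the identity and for the Gaussian convolution, and the sectorised increment -/

section Transfer

open scoped InnerProductSpace

variable {L M : ℕ} [NeZero L] [NeZero M] {N N' : ℕ}

/-- **The `F′`-measurement of `G` does not see the plateau rescaling**: if `Σ_ω F_ω = 1` on the support of `F′` then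
`map (toLin' E(F′)) (map (toLin' S(F̃)) Ṽ) = map (toLin' E(F′)) G`, `Ṽ = sectorPreimage β F G`. [cite: BenfattoGiulianiMastropietro2006, §2.7 (2.70)] -/
theorem map_sectorAnalysis_map_sectorPreimage_of_plateau {β : ℝ} (hβ : β ≠ 0)
    (F Ft : Fin N → FreqMomentum L M → ℂ) (hFF : ∀ ω k, Ft ω k * F ω k = F ω k)
    (hF0 : ∀ k, ∑ ω, F ω k = 0 → ∀ ω, F ω k = 0) (F' : Fin N' → FreqMomentum L M → ℂ) (G : HubbardGrassmann L M)
    (hF'pl : ∀ (ω' : Fin N') (k : FreqMomentum L M), F' ω' k ≠ 0 → ∑ ω, F ω k = 1) :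
    ExteriorAlgebra.map (Matrix.toLin' (sectorAnalysisMatrix L M β F'))
        (ExteriorAlgebra.map (Matrix.toLin' (sectorSubMatrix L M β Ft)) (sectorPreimage β F G)) =
      ExteriorAlgebra.map (Matrix.toLin' (sectorAnalysisMatrix L M β F')) G := by
  set Rf : HubbardFieldIdx L M → ℂ := fun K => ∑ ω, F ω K.1.1 with hRf
  have hcomp : Matrix.toLin' (sectorAnalysisMatrix L M β F') ∘ₗ LinearMap.mulLeft ℂ Rf =
      Matrix.toLin' (sectorAnalysisMatrix L M β F') :=
    toLin'_sectorAnalysis_comp_mulLeft β F' Rf fun ω' K hK => hF'pl ω' K.1.1 hK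
  rw [map_sectorSub_sectorPreimage_eq_map_mulLeft hβ F Ft hFF hF0 G, map_map_eq_map_comp, hcomp]

/-- **The `F′`-measurement of `e^{Δ_C} G` does not see the plateau rescaling**: if `Σ_ω F_ω = 1` on the momenta of `supp C` and of
`supp F′` then `map (toLin' E(F′)) (e^{Δ_C} (map (toLin' S(F̃)) Ṽ)) = map (toLin' E(F′)) (e^{Δ_C} G)`. [cite: BenfattoGiulianiMastropietro2006, §2.7 (2.70)–(2.71)] -/
theorem map_sectorAnalysis_gaussConv_map_sectorPreimage_of_plateau {β : ℝ} (hβ : β ≠ 0)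
    (F Ft : Fin N → FreqMomentum L M → ℂ) (hFF : ∀ ω k, Ft ω k * F ω k = F ω k)
    (hF0 : ∀ k, ∑ ω, F ω k = 0 → ∀ ω, F ω k = 0) (F' : Fin N' → FreqMomentum L M → ℂ) (G : HubbardGrassmann L M)
    (C : Matrix (HubbardFieldIdx L M) (HubbardFieldIdx L M) ℂ)
    (hCpl : ∀ X Y, C X Y ≠ 0 → ∑ ω, F ω X.1.1 = 1 ∧ ∑ ω, F ω Y.1.1 = 1)
    (hF'pl : ∀ (ω' : Fin N') (k : FreqMomentum L M), F' ω' k ≠ 0 → ∑ ω, F ω k = 1) :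
    ExteriorAlgebra.map (Matrix.toLin' (sectorAnalysisMatrix L M β F'))
        (gaussConv ℂ C (ExteriorAlgebra.map (Matrix.toLin' (sectorSubMatrix L M β Ft)) (sectorPreimage β F G))) =
      ExteriorAlgebra.map (Matrix.toLin' (sectorAnalysisMatrix L M β F')) (gaussConv ℂ C G) := by
  set Rf : HubbardFieldIdx L M → ℂ := fun K => ∑ ω, F ω K.1.1 with hRf
  have hcov : ∀ X Y, Rf X * Rf Y * C X Y = C X Y := by
    intro X Y
    by_cases h0 : C X Y = 0
    · rw [h0, mul_zero]
    · obtain ⟨h1, h2⟩ := hCpl X Y h0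
      rw [show Rf X = 1 from h1, show Rf Y = 1 from h2, one_mul, one_mul]
  have hCe : (Matrix.of fun X Y => Rf X * Rf Y * C X Y) = C := Matrix.ext fun X Y => hcov X Y
  have hcomp : Matrix.toLin' (sectorAnalysisMatrix L M β F') ∘ₗ LinearMap.mulLeft ℂ Rf =
      Matrix.toLin' (sectorAnalysisMatrix L M β F') :=
    toLin'_sectorAnalysis_comp_mulLeft β F' Rf fun ω' K hK => hF'pl ω' K.1.1 hK
  rw [map_sectorSub_sectorPreimage_eq_map_mulLeft hβ F Ft hFF hF0 G, gaussConv_map_mulLeft, hCe, map_map_eq_map_comp, hcomp]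

/-- **The FIRST-ORDER increment of the sectorised kernels across one slice, binomial–Gram form** (BGM 2006 (2.61)–(2.63), (2.66), first order,
in the (2.70)–(2.71a) sector currency): thin/fat families `F, F̃` (`F̃F = F`, `ΣF = 0 ⇒ F = 0`), output family `F′` with the plateau of `F`
over the slice `C` and over `F′`, ANY even input `G`, sectorised slice `S(F̃)ᵀ C S(F̃)` replica-Gram-bounded with constant `κ ≥ 0`, overlap
costs `(cr, cc)` of `E(F′)·S(F̃)`; then for every `p ≥ 1` and every constraint set `A`,
`‖e^{Δ_C} G - G‖_{F′, A, 2p} ≤ cr·cc^{2p-1}·ε_x^{2p-1}·Σ_{m' > p} C(2m',2p)·κ^{2m'-2p}·(ε_x·‖G‖_{F, univ, 2m'})` — only the HIGHER kernels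
of `G`, self-contracted; no row/column sums of the slice are needed. [cite: BenfattoGiulianiMastropietro2006, (2.61)-(2.63), (2.66)] -/
theorem hubbardSectorKernelNorm_gaussConv_sub_le_binomial_of_gramBounded_of_plateau
    {β : ℝ} (hβ : 0 < β) (F Ft : Fin N → FreqMomentum L M → ℂ) (hFF : ∀ ω k, Ft ω k * F ω k = F ω k)
    (hF0 : ∀ k, ∑ ω, F ω k = 0 → ∀ ω, F ω k = 0)
    (F' : Fin N' → FreqMomentum L M → ℂ) (G : HubbardGrassmann L M) (hG : G ∈ evenPart ℂ (HubbardFieldIdx L M))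
    (C : Matrix (HubbardFieldIdx L M) (HubbardFieldIdx L M) ℂ)
    (hCpl : ∀ X Y, C X Y ≠ 0 → ∑ ω, F ω X.1.1 = 1 ∧ ∑ ω, F ω Y.1.1 = 1)
    (hF'pl : ∀ (ω' : Fin N') (k : FreqMomentum L M), F' ω' k ≠ 0 → ∑ ω, F ω k = 1)
    {κ : ℝ} (hκ : 0 ≤ κ)
    (hGB : IsGramBoundedR ((sectorSubMatrix L M β Ft).transpose * C * sectorSubMatrix L M β Ft) κ)
    {cr cc : ℝ} (hcr0 : 0 ≤ cr) (hcc0 : 0 ≤ cc)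
    (hrow' : ∀ X'', ∑ X', ‖(sectorAnalysisMatrix L M β F' * sectorSubMatrix L M β Ft) X'' X'‖ ≤ cr)
    (hcol' : ∀ X', ∑ X'', ‖(sectorAnalysisMatrix L M β F' * sectorSubMatrix L M β Ft) X'' X'‖ ≤ cc)
    (p : ℕ) (A : Finset (Fin (2 * p + 1 + 1) → SectorLeg N')) :
    hubbardSectorKernelNorm L M β F' A (gaussConv ℂ C G - G) ≤
      cr * cc ^ (2 * p + 1) * imagTimeWeight β M ^ (2 * p + 1) *
        ∑ m' ∈ range (Fintype.card (SpaceTimeIdx L M × SectorLeg N) / 2 + 1),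
          (if p + 1 < m' then ((2 * m').choose (2 * (p + 1)) : ℝ) * κ ^ (2 * m' - 2 * (p + 1)) *
            (imagTimeWeight β M * hubbardSectorKernelNorm L M β F (univ : Finset (Fin (2 * m') → SectorLeg N)) G) else 0) := by
  -- norm of `G`-objects through `E(F′)`
  refine (hubbardSectorKernelNorm_le_kernelNorm_map hβ.le F' A _).trans ?_
  -- transfer: inside `E(F′)` replace `G` by `map S Ṽ`
  have hid := map_sectorAnalysis_map_sectorPreimage_of_plateau hβ.ne' F Ft hFF hF0 F' G hF'pl
  have hgc := map_sectorAnalysis_gaussConv_map_sectorPreimage_of_plateau hβ.ne' F Ft hFF hF0 F' G C hCpl hF'pl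
  have hrepl : ExteriorAlgebra.map (Matrix.toLin' (sectorAnalysisMatrix L M β F')) (gaussConv ℂ C G - G) =
      ExteriorAlgebra.map (Matrix.toLin' (sectorAnalysisMatrix L M β F'))
        (gaussConv ℂ C (ExteriorAlgebra.map (Matrix.toLin' (sectorSubMatrix L M β Ft)) (sectorPreimage β F G)) -
          ExteriorAlgebra.map (Matrix.toLin' (sectorSubMatrix L M β Ft)) (sectorPreimage β F G)) := by
    rw [map_sub, map_sub, hid, hgc]
  rw [hrepl]
  -- the generic first-order bound with `N′(m′) = ε_x ‖G‖_{F, univ, 2m′}` for `m′ ≥ 1` (the degree-`0` slot never enters)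
  set Nbar : ℕ → ℝ := fun m' => imagTimeWeight β M *
    hubbardSectorKernelNorm L M β F (univ : Finset (Fin (2 * m') → SectorLeg N)) G with hNbar
  set N0 : ℕ → ℝ := fun m' => if m' = 0 then kernelNorm 1 0 (kernel ℂ (sectorPreimage β F G) 0) else Nbar m' with hN0def
  have hNbar0 : ∀ m', 0 ≤ Nbar m' :=
    fun m' => mul_nonneg (imagTimeWeight_nonneg hβ.le M) (hubbardSectorKernelNorm_nonneg hβ.le F univ G)
  have hN00 : ∀ m', 0 ≤ N0 m' := fun m' => by
    simp only [hN0def]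
    split_ifs
    · exact kernelNorm_nonneg zero_le_one _ _
    · exact hNbar0 m'
  have hN : ∀ m', kernelNorm 1 (2 * m') (kernel ℂ (sectorPreimage β F G) (2 * m')) ≤ N0 m' := by
    intro m'
    rcases m' with _ | m'
    · simp only [hN0def, if_true, Nat.mul_zero, le_refl]
    · simp only [hN0def, Nat.succ_ne_zero, if_false, hNbar]
      rw [show 2 * (m' + 1) = 2 * m' + 1 + 1 by ring]
      exact kernelNorm_kernel_sectorPreimage_le hβ.le F G _
  have h := kernelNorm_kernel_map_gaussConv_sub_le_binomial_of_gramBounded C (Matrix.toLin' (sectorSubMatrix L M β Ft))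
    (Matrix.toLin' (sectorAnalysisMatrix L M β F')) (sectorPreimage β F G) (sectorPreimage_mem_evenPart β F hG) hκ
    (by simpa only [LinearMap.toMatrix'_toLin'] using hGB) N0 hN00 hN hcr0 hcc0
    (by simpa only [LinearMap.toMatrix'_toLin'] using hrow') (by simpa only [LinearMap.toMatrix'_toLin'] using hcol')
    (imagTimeWeight_nonneg hβ.le M) p
  refine h.trans (le_of_eq ?_)
  congr 1
  refine sum_congr rfl fun m' _ => ?_
  by_cases hm : p + 1 < m'
  · have hm0 : m' ≠ 0 := by omega
    rw [if_pos hm, if_pos hm]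
    simp only [hN0def, if_neg hm0, hNbar]
  · rw [if_neg hm, if_neg hm]

/-- **The orders `≥ 2` of the increment of the sectorised kernels across one slice** (BGM 2006 (2.61)–(2.63), (2.66), (2.77)): data as in
`hubbardSectorKernelNorm_effAction_le_of_sectorNorm_of_gramBounded_of_plateau` (even input `G` without constant part, plateau of `F`
over the slice and the output family, sectorised slice replica-Gram-bounded with `κ > 0` and row/column sums `≤ α`, radius `ρ`,
`θ̄ = eα‖G‖_h/κ² < 1` with `‖G‖_h = normV Γ′ κ ρ N̄`, `N̄(m′) = ε_x‖G‖_{F,univ,2m′}`, overlap costs `(cr, cc)`); then in every degree `m + 1`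
and for every constraint set `A`, `‖effAction C G - e^{Δ_C} G‖_{F′, A, m+1} ≤ cr cc^m ε_x^m ρ^{-(m+1)} e‖G‖_h θ̄/(1-θ̄)`.
[cite: BenfattoGiulianiMastropietro2006, (2.61)-(2.63), (2.66)] -/
theorem hubbardSectorKernelNorm_effAction_sub_gaussConv_le_of_gramBounded_of_plateau
    {β : ℝ} (hβ : 0 < β) (F Ft : Fin N → FreqMomentum L M → ℂ) (hFF : ∀ ω k, Ft ω k * F ω k = F ω k)
    (hF0 : ∀ k, ∑ ω, F ω k = 0 → ∀ ω, F ω k = 0)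
    (F' : Fin N' → FreqMomentum L M → ℂ) (G : HubbardGrassmann L M) (hG : G ∈ evenPart ℂ (HubbardFieldIdx L M))
    (hG0 : constPart ℂ G = 0)
    (C : Matrix (HubbardFieldIdx L M) (HubbardFieldIdx L M) ℂ)
    (hCpl : ∀ X Y, C X Y ≠ 0 → ∑ ω, F ω X.1.1 = 1 ∧ ∑ ω, F ω Y.1.1 = 1)
    (hF'pl : ∀ (ω' : Fin N') (k : FreqMomentum L M), F' ω' k ≠ 0 → ∑ ω, F ω k = 1)
    {κ : ℝ} (hκ : 0 < κ)
    (hGB : IsGramBoundedR ((sectorSubMatrix L M β Ft).transpose * C * sectorSubMatrix L M β Ft) κ)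
    {α : ℝ} (hα : 0 < α)
    (hrow : ∀ X, ∑ Y, ‖((sectorSubMatrix L M β Ft).transpose * C * sectorSubMatrix L M β Ft) X Y‖ ≤ α)
    (hcol : ∀ Y, ∑ X, ‖((sectorSubMatrix L M β Ft).transpose * C * sectorSubMatrix L M β Ft) X Y‖ ≤ α)
    {ρ : ℝ} (hρ : 0 < ρ)
    (hθ : Real.exp 1 * α * normV (SpaceTimeIdx L M × SectorLeg N) κ ρ
      (fun m' => imagTimeWeight β M *
        hubbardSectorKernelNorm L M β F (univ : Finset (Fin (2 * m') → SectorLeg N)) G) / κ ^ 2 < 1)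
    {cr cc : ℝ} (hcr0 : 0 ≤ cr) (hcc0 : 0 ≤ cc)
    (hrow' : ∀ X'', ∑ X', ‖(sectorAnalysisMatrix L M β F' * sectorSubMatrix L M β Ft) X'' X'‖ ≤ cr)
    (hcol' : ∀ X', ∑ X'', ‖(sectorAnalysisMatrix L M β F' * sectorSubMatrix L M β Ft) X'' X'‖ ≤ cc)
    (m : ℕ) (A : Finset (Fin (m + 1) → SectorLeg N')) :
    hubbardSectorKernelNorm L M β F' A (effAction ℂ C G - gaussConv ℂ C G) ≤
      cr * cc ^ m * imagTimeWeight β M ^ m * (ρ⁻¹ ^ (m + 1) *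
        (Real.exp 1 * normV (SpaceTimeIdx L M × SectorLeg N) κ ρ
          (fun m' => imagTimeWeight β M *
            hubbardSectorKernelNorm L M β F (univ : Finset (Fin (2 * m') → SectorLeg N)) G)) *
          (Real.exp 1 * α * normV (SpaceTimeIdx L M × SectorLeg N) κ ρ
            (fun m' => imagTimeWeight β M *
              hubbardSectorKernelNorm L M β F (univ : Finset (Fin (2 * m') → SectorLeg N)) G) / κ ^ 2) /
          (1 - Real.exp 1 * α * normV (SpaceTimeIdx L M × SectorLeg N) κ ρ
            (fun m' => imagTimeWeight β M *
              hubbardSectorKernelNorm L M β F (univ : Finset (Fin (2 * m') → SectorLeg N)) G) / κ ^ 2)) := by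
  set nVbar : ℝ := normV (SpaceTimeIdx L M × SectorLeg N) κ ρ (fun m' => imagTimeWeight β M *
    hubbardSectorKernelNorm L M β F (univ : Finset (Fin (2 * m') → SectorLeg N)) G) with hnVbar
  set nV : ℝ := normV (SpaceTimeIdx L M × SectorLeg N) κ ρ
    (fun m' => kernelNorm 1 (2 * m') (kernel ℂ (sectorPreimage β F G) (2 * m'))) with hnV
  have hle : nV ≤ nVbar := normV_mono hκ.le hρ.le fun m' => kernelNorm_kernel_sectorPreimage_two_mul_le hβ.le F G hG0 m'
  have hnV0 : 0 ≤ nV := normV_nonneg hκ.le hρ.le fun m' => kernelNorm_nonneg zero_le_one _ _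
  have hθ' : Real.exp 1 * α * nV / κ ^ 2 < 1 := lt_of_le_of_lt (by gcongr) hθ
  -- norm of `G`-objects through `E(F′)` and transfer
  refine (hubbardSectorKernelNorm_le_kernelNorm_map hβ.le F' A _).trans ?_
  have hea := map_sectorAnalysis_effAction_map_sectorPreimage_of_plateau hβ.ne' F Ft hFF hF0 F' G C hCpl hF'pl
  have hgc := map_sectorAnalysis_gaussConv_map_sectorPreimage_of_plateau hβ.ne' F Ft hFF hF0 F' G C hCpl hF'pl
  have hrepl : ExteriorAlgebra.map (Matrix.toLin' (sectorAnalysisMatrix L M β F')) (effAction ℂ C G - gaussConv ℂ C G) =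
      ExteriorAlgebra.map (Matrix.toLin' (sectorAnalysisMatrix L M β F'))
        (effAction ℂ C (ExteriorAlgebra.map (Matrix.toLin' (sectorSubMatrix L M β Ft)) (sectorPreimage β F G)) -
          gaussConv ℂ C (ExteriorAlgebra.map (Matrix.toLin' (sectorSubMatrix L M β Ft)) (sectorPreimage β F G))) := by
    rw [map_sub, map_sub, hea, hgc]
  rw [hrepl]
  have h := kernelNorm_kernel_map_effAction_sub_gaussConv_le_of_gramBounded C (Matrix.toLin' (sectorSubMatrix L M β Ft))
    (Matrix.toLin' (sectorAnalysisMatrix L M β F')) (sectorPreimage β F G) (sectorPreimage_mem_evenPart β F hG)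
    (by rw [constPart_sectorPreimage, hG0]) hκ (by simpa only [LinearMap.toMatrix'_toLin'] using hGB) hα
    (by simpa only [LinearMap.toMatrix'_toLin'] using hrow) (by simpa only [LinearMap.toMatrix'_toLin'] using hcol) hρ hθ' hcr0 hcc0
    (by simpa only [LinearMap.toMatrix'_toLin'] using hrow') (by simpa only [LinearMap.toMatrix'_toLin'] using hcol')
    (imagTimeWeight_nonneg hβ.le M) m
  refine h.trans ?_
  -- monotonicity of `x ↦ e x (e α x/κ²)/(1 - e α x/κ²)` in the norm
  have hnVbar0 : 0 ≤ nVbar := hnV0.trans hle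
  have hθbar0 : 0 ≤ Real.exp 1 * α * nVbar / κ ^ 2 := by positivity
  have hθv0 : 0 ≤ Real.exp 1 * α * nV / κ ^ 2 := by positivity
  have hmono : Real.exp 1 * nV * (Real.exp 1 * α * nV / κ ^ 2) / (1 - Real.exp 1 * α * nV / κ ^ 2) ≤
      Real.exp 1 * nVbar * (Real.exp 1 * α * nVbar / κ ^ 2) / (1 - Real.exp 1 * α * nVbar / κ ^ 2) := by
    have hx1 : Real.exp 1 * α * nV / κ ^ 2 ≤ Real.exp 1 * α * nVbar / κ ^ 2 := by gcongr
    have hpos : 0 < 1 - Real.exp 1 * α * nVbar / κ ^ 2 := by linarith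
    have hnum : Real.exp 1 * nV * (Real.exp 1 * α * nV / κ ^ 2) ≤ Real.exp 1 * nVbar * (Real.exp 1 * α * nVbar / κ ^ 2) :=
      mul_le_mul (mul_le_mul_of_nonneg_left hle (Real.exp_pos 1).le) hx1 hθv0 (mul_nonneg (Real.exp_pos 1).le hnVbar0)
    exact div_le_div₀ (mul_nonneg (mul_nonneg (Real.exp_pos 1).le hnVbar0) hθbar0) hnum hpos (by linarith)
  have hε : 0 ≤ imagTimeWeight β M := imagTimeWeight_nonneg hβ.le M
  calc cr * cc ^ m * imagTimeWeight β M ^ m * (ρ⁻¹ ^ (m + 1) * (Real.exp 1 * nV) * (Real.exp 1 * α * nV / κ ^ 2) /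
        (1 - Real.exp 1 * α * nV / κ ^ 2))
      = cr * cc ^ m * imagTimeWeight β M ^ m * ρ⁻¹ ^ (m + 1) *
          (Real.exp 1 * nV * (Real.exp 1 * α * nV / κ ^ 2) / (1 - Real.exp 1 * α * nV / κ ^ 2)) := by ring
    _ ≤ cr * cc ^ m * imagTimeWeight β M ^ m * ρ⁻¹ ^ (m + 1) *
          (Real.exp 1 * nVbar * (Real.exp 1 * α * nVbar / κ ^ 2) / (1 - Real.exp 1 * α * nVbar / κ ^ 2)) :=
        mul_le_mul_of_nonneg_left hmono (by positivity)
    _ = _ := by ring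

end Transfer

end Literature.MathematicalPhysics.QuantumLattice

end
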